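import Summits.ABC.IUTFork.Joshi.FundamentalEstimateBLActualLocus
import Summits.ABC.IUTFork.Joshi.ThetaLocusPrototype
import Summits.ABC.IUTFork.Joshi.PrototypeExponentModel
import HarnessLib

/-!
# The ONE located input (STD) of the [J-III] Thm. 7.3.1 chain IS E-t3's typed `PrototypeDatum.CanonicalPoint`
# ([J-IIp] proof of Thm. 9.2.1, p.27): `StandardPointNorms` / `FundamentalEstimateBL` from typed Joshi structures ALONE,
# and the structure is INHABITED at the model of record (proof-only, 0 definitions)

Proof-only companion (abc-iut cell, block E → R-J «Joshi Y-discharge census», rung LADDER-ABC:A2.RESCUE.J; seat abc-iut-E-t13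
gen 7, R-J census typer #1; census `HOME/plan/E/R-J/census-t13.tsv` rows Y-31 / T13-01 / T13-02) of
* `Joshi/StandardPointNormsSupply.lean` (abc-iut-E-t8, p431046) and `Joshi/FundamentalEstimateBLActualLocus.lean` (abc-iut-E-t12
  gen 2, p435150): [J-III] Thm. 7.3.1 AS TYPED (`ATS3.AdelicThetaDatum.FundamentalEstimateBL`, K. Joshi, arXiv:2401.13508v4
  p.55 l.1–30, never asserted) DERIVED from E-t3's one-prime `PrototypeDatum` ([J-IIp] = arXiv:2303.01662v3 Thm. 6.9.1 + §5.1)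
  under carrier glue (G1)–(G3), the membership (ANS) «the `w`-component of `z_Θ` is a primitive-Ansatz tuple `(y_j(a))_j`»
  and ONE LOCATED INLINE BINDER (STD) `hstd : scale (z_Θ last) = 1` «the residue field at the last coordinate of `z_Θ` is
  `ℂ_p` with its STANDARD valuation» ([J-III] §4.4 p.35 l.87–97, §4.5 p.36 l.11–17; [J-IIp] p.27 l.8–12; [FF18] §10.1.1 /
  Prop. 10.1.1 / Thm. 6.5.2 (3), as located by abc-iut-E-lit, plan/E/lit/YPS-CENSUS-T13.tsv);
* `Joshi/ThetaLocusPrototype.lean` (abc-iut-E-t3, p428775): the HYPOTHESIS structure `PrototypeDatum.CanonicalPoint` =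
  «the canonical-point datum of the proof of Thm. 9.2.1 (p.27 l.5–30): `t ∈ ℂ♭_p` with `([t] − p) ↔ y_0`, `π(y_0) = x_can`,
  `K_{y_0} = ℂ_p` with the normalised valuation (`scale (pt t) = 1`), `a = t^{1/ℓ⋆²}`» — print-located there to
  [FF18, Thm. 10.1.1 / Prop. 10.1.1] + algebraic closedness of `ℂ♭_p`; never asserted.

WHAT THIS FILE RECORDS (kernel glue only; no new `Prop`, no `def`, no FACT-LIST row, nothing of Joshi or [IUTchIII] asserted):
1. `PrototypeDatum.CanonicalPoint.scale_ansatzPt_lastIdx` — for a canonical-point datum `c`, the LAST point `y_{ℓ⋆}(c.a)` of the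
   Ansatz tuple of `c.a` has `scale = 1` (it IS `pt c.t`, E-t3's `ansatzPt_last`): i.e. (ANS) with `a := c.a` IMPLIES (STD).
2. `ATS3.AdelicThetaDatum.standardPointNorms_of_canonicalPoint` / `fundamentalEstimateBL_of_canonicalPoint` — E-t8's
   supply theorems with the inline binders `(a, ha, hstd)` REPLACED by one typed Joshi structure per bad place,
   `c : ∀ w, (P w).CanonicalPoint`, and (ANS) stated for `a := (c w).a`; likewise ON THE ACTUAL LOCUS `Θ̃^{B_{L′}}` of Def. 6.10.2
   (`ATS3.AdelicLiftDatum.standardPointNorms_of_canonicalPoint`, `…fundamentalEstimateBL_of_canonicalPoint`,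
   `…localThetaEstimate_of_canonicalPoint`), composing p435150.
   UPSHOT for the census (row T13-02): the located input (STD) is not a free-floating sentence — it is the field
   `CanonicalPoint.scale_pt_t` of a typed [J-IIp] hypothesis structure already in the tree, so Y-31's J-side reads «DERIVED from
   typed [J-IIp]/[J-III] structures (PrototypeDatum + CanonicalPoint + lift data + glue)», the print locus of the residual being
   [J-IIp] p.27 / [FF18] Thm. 10.1.1 as E-t3 recorded it.
3. `canonicalPoint_inhabited` / `exists_prototypeDatum_with_canonicalPoint` — the structure is INHABITED at E-t3's model of record
   (`ExpModel.prototypeDatum p`, `ExpModel.canonicalPoint p`: `t = p`, `a = p^{1/4}`, PrototypeExponentModel p428903-lineage) —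
   so (STD) is SATISFIABLE jointly with the whole one-prime signature (non-vacuity of the typed input at one prime; the adelic
   glue (G1)–(G3) to an `AdelicLiftDatum` is not instantiated here).
FRAMING (binding): locates / conditionally verifies; NO abc claim; no side taken on [IUTchIII] Cor. 3.12, on Joshi's claims or on
Mochizuki's report on them (or on Scholze–Stix / Dupuy–Hilado); typed ≠ proved ≠ endorsed; the model is a LOGICAL model of E-t3's
signature, nothing about [FF18]'s curve. bears_on: LADDER-ABC:A2.RESCUE.J
-/

noncomputable section

namespace Summit.ABC.IUTFork.Joshi

/-! ## 1. One prime: a canonical-point datum supplies (ANS)'s parameter and (STD) -/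

namespace PrototypeDatum

variable {F B E0 : Type} [Field F] [CommRing B] [Field E0] {Y : Type} {K : Y → Type} [∀ y, Field (K y)] {G : Type}
  {P : PrototypeDatum F B E0 Y K G}

namespace CanonicalPoint

variable (c : P.CanonicalPoint)

/-- E-t8's last index `lastIdx` IS the index of E-t3's `ansatzPt_last` (both `⟨ℓ⋆ − 1, _⟩`). [folklore] -/
theorem ansatzPt_lastIdx : P.ansatzPt c.a P.lastIdx = P.pt c.t := c.ansatzPt_last

/-- **(ANS) with the canonical-point parameter IMPLIES (STD)**: the last Ansatz point `y_{ℓ⋆}(a)`, `a = t^{1/ℓ⋆²}`, is the point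
`y_0 = pt t` over the canonical point, whose scaling exponent is `1` («`K_{ℓ⋆} = ℂ_p`», [J-IIp] p.27 l.10–12, 29–30). [folklore] -/
theorem scale_ansatzPt_lastIdx : P.scale (P.ansatzPt c.a P.lastIdx) = 1 := by
  rw [c.ansatzPt_lastIdx]; exact c.scale_pt_t

/-- Hence the residue-field size of the theta value along the canonical Ansatz tuple: `|ξ|_{K_{y_j(a)}} = |ξ|_0^{j²/ℓ⋆²}`
(E-t8's `absK_xi_ansatzPt_of_std` with its `hstd` discharged by the structure). [folklore] -/
theorem absK_xi_ansatzPt (i : Fin P.lstar) :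
    P.absK (P.ansatzPt c.a i) (P.emb (P.ansatzPt c.a i) P.xi) =
      P.abs0 P.xi ^ ((((i : ℕ) : ℝ) + 1) ^ 2 / ((P.lstar : ℝ) ^ 2)) :=
  P.absK_xi_ansatzPt_of_std c.a_mem c.scale_ansatzPt_lastIdx i

/-- … and at the last label `|ξ|_{K_{y_{ℓ⋆}}} = |ξ|_0 = |q|_0^{1/2ℓ}`. [folklore] -/
theorem absK_xi_last :
    P.absK (P.ansatzPt c.a P.lastIdx) (P.emb (P.ansatzPt c.a P.lastIdx) P.xi) =
      P.abs0 P.q ^ (1 / (2 * ((2 * P.lstar + 1 : ℕ) : ℝ))) :=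
  P.absK_xi_last_of_std c.scale_ansatzPt_lastIdx

end CanonicalPoint

end PrototypeDatum

/-! ## 2. The abstract §7 datum: E-t8's supply theorems with (STD) replaced by the typed structure -/

namespace ATS3

namespace AdelicThetaDatum

variable (D : AdelicThetaDatum)

/-- **`StandardPointNorms` from the prototypes and ONE CANONICAL-POINT DATUM PER BAD PLACE** (no located inline binder): E-t8's
`standardPointNorms_of_prototype` (p431046) with `a := (c w).a`, `ha := (c w).a_mem` and `hstd` DISCHARGED by
`CanonicalPoint.scale_ansatzPt_lastIdx`. Hypothesis set = E-t10's lift data ∧ (G1)–(G3) ∧ (ANS for the canonical parameter) ∧ the typed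
[J-IIp] structure `CanonicalPoint`. [claim: Joshi2024ATS3, status: disputed] -/
theorem standardPointNorms_of_canonicalPoint {OE : D.W → Type} [∀ w, CommRing (OE w)] [∀ w, CommRing (D.B w)]
    [∀ w, Algebra (OE w) (D.B w)] {Y : D.W → Type} (L : ∀ w, ThetaLiftDatum (OE w) (D.B w) (Y w))
    (hnrm : ∀ w ∈ D.Vss, ∀ (ρ : ℝ) (x : D.B w), (L w).norm ρ x = D.nrm w ρ x)
    (y : ∀ w, Fin D.lstar → Y w) (z : ∀ w, Fin D.lstar → (L w).Cflat)
    (hz : ∀ w ∈ D.Vss, ∀ i : Fin D.lstar, (L w).IsTeichLift (y w i) (z w i))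
    (hXi : ∀ w ∈ D.Vss, D.Xi D.std w = (L w).admissibleLift (y w) (z w) (0 : OE w))
    {F B₀ E₀ : D.W → Type} [∀ w, Field (F w)] [∀ w, CommRing (B₀ w)] [∀ w, Field (E₀ w)]
    {K : ∀ w, Y w → Type} [∀ w (y : Y w), Field (K w y)] {G : D.W → Type}
    (P : ∀ w, PrototypeDatum (F w) (B₀ w) (E₀ w) (Y w) (K w) (G w))
    (hl : ∀ w ∈ D.Vss, (P w).lstar = D.lstar)
    (hq0 : ∀ w ∈ D.Vss, (P w).abs0 (P w).q = D.qAbs w)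
    (hxi : ∀ w ∈ D.Vss, ∀ i : Fin D.lstar,
      (L w).absK (y w i) ((L w).xi (y w i)) = (P w).absK (y w i) ((P w).emb (y w i) (P w).xi))
    (c : ∀ w, (P w).CanonicalPoint)
    (hy : ∀ w (hw : w ∈ D.Vss) (i : Fin D.lstar), y w i = (P w).ansatzPt (c w).a (Fin.cast (hl w hw).symm i)) :
    D.StandardPointNorms := by
  refine D.standardPointNorms_of_prototype L hnrm y z hz hXi P hl hq0 hxi (fun w => (c w).a) (fun w _ => (c w).a_mem) hy ?_
  intro w hw
  have hlast : Fin.cast (hl w hw).symm D.lastLabel = (P w).lastIdx := by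
    apply Fin.ext
    simp only [Fin.val_cast, lastLabel, PrototypeDatum.lastIdx, hl w hw]
  rw [hy w hw, hlast]
  exact (c w).scale_ansatzPt_lastIdx

/-- **[J-III] Thm. 7.3.1 AS TYPED from typed Joshi structures alone** (for every `ℓ ≥ 5`): E-t8's `fundamentalEstimateBL_of_prototype`
with (STD) supplied by `CanonicalPoint`. A conditional kernel statement about a typed candidate; nothing asserted about its
inputs. [claim: Joshi2024ATS3, status: disputed] -/
theorem fundamentalEstimateBL_of_canonicalPoint {OE : D.W → Type} [∀ w, CommRing (OE w)] [∀ w, CommRing (D.B w)]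
    [∀ w, Algebra (OE w) (D.B w)] {Y : D.W → Type} (L : ∀ w, ThetaLiftDatum (OE w) (D.B w) (Y w))
    (hnrm : ∀ w ∈ D.Vss, ∀ (ρ : ℝ) (x : D.B w), (L w).norm ρ x = D.nrm w ρ x)
    (y : ∀ w, Fin D.lstar → Y w) (z : ∀ w, Fin D.lstar → (L w).Cflat)
    (hz : ∀ w ∈ D.Vss, ∀ i : Fin D.lstar, (L w).IsTeichLift (y w i) (z w i))
    (hXi : ∀ w ∈ D.Vss, D.Xi D.std w = (L w).admissibleLift (y w) (z w) (0 : OE w))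
    {F B₀ E₀ : D.W → Type} [∀ w, Field (F w)] [∀ w, CommRing (B₀ w)] [∀ w, Field (E₀ w)]
    {K : ∀ w, Y w → Type} [∀ w (y : Y w), Field (K w y)] {G : D.W → Type}
    (P : ∀ w, PrototypeDatum (F w) (B₀ w) (E₀ w) (Y w) (K w) (G w))
    (hl : ∀ w ∈ D.Vss, (P w).lstar = D.lstar)
    (hq0 : ∀ w ∈ D.Vss, (P w).abs0 (P w).q = D.qAbs w)
    (hxi : ∀ w ∈ D.Vss, ∀ i : Fin D.lstar,
      (L w).absK (y w i) ((L w).xi (y w i)) = (P w).absK (y w i) ((P w).emb (y w i) (P w).xi))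
    (c : ∀ w, (P w).CanonicalPoint)
    (hy : ∀ w (hw : w ∈ D.Vss) (i : Fin D.lstar), y w i = (P w).ansatzPt (c w).a (Fin.cast (hl w hw).symm i)) :
    D.FundamentalEstimateBL :=
  D.fundamentalEstimateBL_of_standardPointNorms (D.standardPointNorms_of_canonicalPoint L hnrm y z hz hXi P hl hq0 hxi c hy)

end AdelicThetaDatum

/-! ## 3. On the ACTUAL locus `Θ̃^{B_{L′}}_Joshi` (Def. 6.10.2, re-keyed datum): p435150 with (STD) supplied by the structure -/

namespace AdelicLiftDatum

variable {A : CollationDatum} {OE B : A.V → Type} [∀ w, CommRing (OE w)] [∀ w, CommRing (B w)]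
  [∀ w, Algebra (OE w) (B w)] (𝔇 : AdelicLiftDatum A OE B)
  {F B₀ E₀ : A.V → Type} [∀ w, Field (F w)] [∀ w, CommRing (B₀ w)] [∀ w, Field (E₀ w)]
  {K : ∀ w, A.Y w → Type} [∀ w (y : A.Y w), Field (K w y)] {G : A.V → Type}

/-- The cast of the re-keyed datum's last label is the prototype's last index. [folklore] -/
theorem cast_lastLabel_eq_lastIdx (X : 𝔇.BLData) (P : ∀ w, PrototypeDatum (F w) (B₀ w) (E₀ w) (A.Y w) (K w) (G w))
    {w : A.V} (hl : (P w).lstar = A.lstar) :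
    Fin.cast hl.symm (𝔇.toAdelicThetaDatum X).lastLabel = (P w).lastIdx := by
  apply Fin.ext
  simp only [Fin.val_cast, AdelicThetaDatum.lastLabel, PrototypeDatum.lastIdx, hl]
  rfl

/-- **`StandardPointNorms` ON THE ACTUAL LOCUS from the prototypes and canonical-point data** (p435150's
`standardPointNorms_of_prototype` with `hstd` discharged). [claim: Joshi2024ATS3, status: disputed] -/
theorem standardPointNorms_of_canonicalPoint (X : 𝔇.BLData)
    (P : ∀ w, PrototypeDatum (F w) (B₀ w) (E₀ w) (A.Y w) (K w) (G w))
    (hl : ∀ w ∈ A.Voddss, (P w).lstar = A.lstar)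
    (hq0 : ∀ w ∈ A.Voddss, (P w).abs0 (P w).q = X.qAbs w)
    (hxi : ∀ w ∈ A.Voddss, ∀ j : Fin A.lstar,
      (𝔇.lift w).absK (A.wComponent X.zTheta w j) ((𝔇.lift w).xi (A.wComponent X.zTheta w j)) =
        (P w).absK (A.wComponent X.zTheta w j) ((P w).emb (A.wComponent X.zTheta w j) (P w).xi))
    (c : ∀ w, (P w).CanonicalPoint)
    (hy : ∀ w (hw : w ∈ A.Voddss) (j : Fin A.lstar),
      A.wComponent X.zTheta w j = (P w).ansatzPt (c w).a (Fin.cast (hl w hw).symm j)) :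
    (𝔇.toAdelicThetaDatum X).StandardPointNorms := by
  refine 𝔇.standardPointNorms_of_prototype X P hl hq0 hxi (fun w => (c w).a) (fun w _ => (c w).a_mem) hy ?_
  intro w hw
  rw [hy w hw, 𝔇.cast_lastLabel_eq_lastIdx X P (hl w hw)]
  exact (c w).scale_ansatzPt_lastIdx

/-- **[J-III] Thm. 7.3.1 AS TYPED, ON THE ACTUAL LOCUS, from typed Joshi structures alone** (every `ℓ ≥ 5`): p435150's
`fundamentalEstimateBL_of_prototype` with (STD) := `CanonicalPoint.scale_pt_t`. Inputs: E-t11's §6 objects (`AdelicLiftDatum`,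
`BLData`), E-t3's `PrototypeDatum` + `CanonicalPoint` per bad place, glue (G1) `hl`, (G2) `hq0`, (G3) `hxi`, membership (ANS) `hy`.
[claim: Joshi2024ATS3, status: disputed] -/
theorem fundamentalEstimateBL_of_canonicalPoint (X : 𝔇.BLData)
    (P : ∀ w, PrototypeDatum (F w) (B₀ w) (E₀ w) (A.Y w) (K w) (G w))
    (hl : ∀ w ∈ A.Voddss, (P w).lstar = A.lstar)
    (hq0 : ∀ w ∈ A.Voddss, (P w).abs0 (P w).q = X.qAbs w)
    (hxi : ∀ w ∈ A.Voddss, ∀ j : Fin A.lstar,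
      (𝔇.lift w).absK (A.wComponent X.zTheta w j) ((𝔇.lift w).xi (A.wComponent X.zTheta w j)) =
        (P w).absK (A.wComponent X.zTheta w j) ((P w).emb (A.wComponent X.zTheta w j) (P w).xi))
    (c : ∀ w, (P w).CanonicalPoint)
    (hy : ∀ w (hw : w ∈ A.Voddss) (j : Fin A.lstar),
      A.wComponent X.zTheta w j = (P w).ansatzPt (c w).a (Fin.cast (hl w hw).symm j)) :
    (𝔇.toAdelicThetaDatum X).FundamentalEstimateBL :=
  (𝔇.toAdelicThetaDatum X).fundamentalEstimateBL_of_standardPointNorms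
    (𝔇.standardPointNorms_of_canonicalPoint X P hl hq0 hxi c hy)

/-- **The local step at every `ρ ∈ (0,1]` ON THE ACTUAL LOCUS** (row Y-32, charitable reading), from typed structures alone.
[claim: Joshi2024ATS3, status: disputed] -/
theorem localThetaEstimate_of_canonicalPoint (X : 𝔇.BLData)
    (P : ∀ w, PrototypeDatum (F w) (B₀ w) (E₀ w) (A.Y w) (K w) (G w))
    (hl : ∀ w ∈ A.Voddss, (P w).lstar = A.lstar)
    (hq0 : ∀ w ∈ A.Voddss, (P w).abs0 (P w).q = X.qAbs w)
    (hxi : ∀ w ∈ A.Voddss, ∀ j : Fin A.lstar,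
      (𝔇.lift w).absK (A.wComponent X.zTheta w j) ((𝔇.lift w).xi (A.wComponent X.zTheta w j)) =
        (P w).absK (A.wComponent X.zTheta w j) ((P w).emb (A.wComponent X.zTheta w j) (P w).xi))
    (c : ∀ w, (P w).CanonicalPoint)
    (hy : ∀ w (hw : w ∈ A.Voddss) (j : Fin A.lstar),
      A.wComponent X.zTheta w j = (P w).ansatzPt (c w).a (Fin.cast (hl w hw).symm j)) :
    (𝔇.toAdelicThetaDatum X).LocalThetaEstimate :=
  (𝔇.toAdelicThetaDatum X).localThetaEstimate_of_standardPointNorms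
    (𝔇.standardPointNorms_of_canonicalPoint X P hl hq0 hxi c hy)

end AdelicLiftDatum

end ATS3

/-! ## 4. Non-vacuity of the typed input at one prime: the structure is inhabited at E-t3's model of record -/

/-- **The canonical-point structure is INHABITED at the model of record** (`ExpModel.prototypeDatum p` over `Q̄_p`,
`ExpModel.canonicalPoint p`: `t = p`, `a = p^{1/4}`, `scale (pt p) = 1`), so (STD) is jointly satisfiable with the whole one-prime
signature of [J-IIp] as typed. [folklore] -/
theorem canonicalPoint_inhabited (p : ℕ) [Fact p.Prime] : Nonempty ((ExpModel.prototypeDatum p).CanonicalPoint) :=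
  ⟨ExpModel.canonicalPoint p⟩

/-- … packaged as an existence statement over E-t3's carriers (one witness per prime `p`). [folklore] -/
theorem exists_prototypeDatum_with_canonicalPoint (p : ℕ) [Fact p.Prime] :
    ∃ P : PrototypeDatum (PadicAlgCl p) (ℚ → PadicAlgCl p) (PadicAlgCl p) ℚ (fun _ => PadicAlgCl p) Unit,
      Nonempty P.CanonicalPoint ∧ ∀ c : P.CanonicalPoint, P.scale (P.ansatzPt c.a P.lastIdx) = 1 :=
  ⟨ExpModel.prototypeDatum p, ⟨ExpModel.canonicalPoint p⟩, fun c => c.scale_ansatzPt_lastIdx⟩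

end Summit.ABC.IUTFork.Joshi

end
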